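import Literature.Geometry.Lorentzian.FinalEraPackage2
import Summits.FinalStateConjecture.FinalStateConjecture.Theorems.DissipativeFinalMotionsDispersingCaptureStubHoverLeg
import HarnessLib

/-!
# Stub H_zone `stub_zoneHover` — hover of a zone point to a later truncated slab
# (crux `DispersingCapture`, stmt-FinalStateConjecture-17643, line `registered`, skeleton r11; lead prover c6, 2026-08-17)

Route `DissipativeFinalMotions` of the summit `FinalStateConjecture`. From the landed certified hover leg `stub_hoverLeg`
(p165236): a point `x` of a rest-frame Kerr–Schild chart with `100M ≤ r(x) ≤ L ≤ R'`, `x⁰ ∈ [τ₀, τ₁]`, truncated `C²`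
deviation `≤ 1/20` out to radius `L` on every slab after `τ₀`, and `dΨ(V)` future-directed at `x`, causally precedes the
truncated slab `Ψ({t* = τ₁, r ≤ R'})` (hover along `x + [0, τ₁ − x⁰] e₀`; the Kerr–Schild radius is constant along `e₀`;
pointwise deviation bound from the slab-wise one by `norm_deviation_le_of_supCkENorm_le`; the degenerate case `τ₁ = x⁰` by
`subset_causalPast`).

References: O'Neill 1983, Ch. 14, p. 402; Visser arXiv:0706.0622, (35).
-/

set_option linter.dupNamespace false

noncomputable section

open scoped Manifold ContDiff Topology
open Filter Set Function MeasureTheory Literature.Geometry.Lorentzian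

namespace Summit.FinalStateConjecture.FinalStateConjecture.Theorems.DissipativeFinalMotions.DispersingCapture

/-- **H_zone — zone hover.** `100M ≤ r(x) ≤ L ≤ R'`, `τ₀ ≤ x⁰ ≤ τ₁`, `truncDeviationCk … 2 L τ ≤ 1/20` for `τ ≥ τ₀`, `dΨ(V)`
future-directed at `x` ⟹ `Ψ x ∈ J⁻(Ψ(truncTimeSlab R' τ₁))`. O'Neill 1983, Ch. 14, p. 402. -/
theorem stub_zoneHover : open scoped Manifold Topology in ∀ (X : Type) [TopologicalSpace X] [ChartedSpace (EuclideanSpace ℝ (Fin 3)) X] [IsManifold (𝓡 3) ((⊤ : ℕ∞) : WithTop ℕ∞) X] [T2Space X] [SecondCountableTopology X] [ConnectedSpace X], ∀ (D : Literature.Geometry.Lorentzian.InitialDataSet (𝓡 3) X) (𝒟 : Literature.Geometry.Lorentzian.VacuumCauchyDevelopment D) (M a : ℝ) (Ψ : (Literature.Geometry.Lorentzian.Kerr.background M a).domain → 𝒟.carrier) (x : (Literature.Geometry.Lorentzian.Kerr.background M a).domain) (L R' τ₀ τ₁ : ℝ), 0 ≤ M → ContMDiff 𝓘(ℝ, Literature.Geometry.Lorentzian.E4)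 (𝓡 4) ((⊤ : ℕ∞) : WithTop ℕ∞) Ψ → 100 * M ≤ Literature.Geometry.Lorentzian.Kerr.radius a x.1 → Literature.Geometry.Lorentzian.Kerr.radius a x.1 ≤ L → L ≤ R' → τ₀ ≤ x.1 0 → x.1 0 ≤ τ₁ → (∀ τ, τ₀ ≤ τ → 𝒟.toSpacetime.truncDeviationCk (Literature.Geometry.Lorentzian.Kerr.background M a) Ψ 2 L τ ≤ ENNReal.ofReal (1 / 20)) → 𝒟.toSpacetime.timeOrientation.IsFutureDirected (mfderiv 𝓘(ℝ, Literature.Geometry.Lorentzian.E4) (𝓡 4) Ψ x (Literature.Geometry.Lorentzian.Kerr.timeVector M a x.1)) →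
    Ψ x ∈ 𝒟.toSpacetime.metric.causalPast 𝒟.toSpacetime.timeOrientation (Ψ '' (Literature.Geometry.Lorentzian.Kerr.background M a).truncTimeSlab R' τ₁) := by
  intro X _ _ _ _ _ _ D 𝒟 M a Ψ x L R' τ₀ τ₁ hM hΨ hr hrL hLR hτ₀ hτ₁ hdev hV
  rcases hτ₁.eq_or_lt with heq | hlt
  · -- degenerate case `x⁰ = τ₁`: `x` lies on the truncated slab itself
    exact LorentzianMetric.subset_causalPast 𝒟.toSpacetime.metric 𝒟.toSpacetime.timeOrientation _
      (mem_image_of_mem Ψ (show x ∈ (Kerr.background M a).truncTimeSlab R' τ₁ from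
        ⟨heq, hrL.trans hLR⟩))
  · -- hover along `x + [0, τ₁ − x⁰] e₀`
    have hs : 0 < τ₁ - x.1 0 := sub_pos.2 hlt
    -- pointwise deviation bound on the hover segment from the slab-wise truncated `C²` bound
    have hpt : ∀ z : (Kerr.background M a).domain, x.1 0 ≤ z.1 0 → z.1 0 ≤ x.1 0 + (τ₁ - x.1 0) →
        E4.spatial z.1 = E4.spatial x.1 →
        ‖𝒟.toSpacetime.deviation (Kerr.background M a) Ψ z‖ ≤ 1 / 20 := by
      intro z hz0 _ hsp
      have hrz : Kerr.radius a z.1 = Kerr.radius a x.1 := Kerr.radius_eq_of_spatial_eq a hsp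
      have hzmem : z ∈ (Kerr.background M a).truncTimeSlab L (z.1 0) :=
        ⟨rfl, show Kerr.radius a z.1 ≤ L by rw [hrz]; exact hrL⟩
      exact BoostedKerrLegs.norm_deviation_le_of_supCkENorm_le 𝒟.toSpacetime (Kerr.background M a) Ψ
        (by norm_num) (hdev (z.1 0) (hτ₀.trans hz0)) z hzmem
    obtain ⟨z, hz, hmem⟩ := stub_hoverLeg X D 𝒟 M a Ψ x (τ₁ - x.1 0) hM hs hΨ hr hpt hV
    -- the endpoint `z = x + (τ₁ − x⁰) e₀` lies on the truncated slab `{t* = τ₁, r ≤ R'}`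
    have hzslab : z ∈ (Kerr.background M a).truncTimeSlab R' τ₁ := by
      refine ⟨?_, ?_⟩
      · show z.1 0 = τ₁
        rw [hz]
        simp
      · show Kerr.radius a z.1 ≤ R'
        rw [hz, Kerr.radius_add_time_smul_basisVector]
        exact hrL.trans hLR
    exact LorentzianMetric.causalFuture_mono (τ := 𝒟.toSpacetime.timeOrientation.reverse)
      (singleton_subset_iff.2 (mem_image_of_mem Ψ hzslab)) hmem

end Summit.FinalStateConjecture.FinalStateConjecture.Theorems.DissipativeFinalMotions.DispersingCapture

end
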